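import Summits.BirchSwinnertonDyer.BirchSwinnertonDyer.Theorems.BiquadraticEisensteinDescentHeegnerTwistCouplingInSupplySymbolicMonskyOddKernelParity
import HarnessLib

set_option linter.dupNamespace false -- `Summit.BirchSwinnertonDyer.BirchSwinnertonDyer.Theorems.…` (summit = sub)
set_option autoImplicit false

/-!
# Crux `HeegnerTwistCouplingInSupply` (stmt-BirchSwinnertonDyer-21381) — ODD UNIVERSALITY FAILS TOO: the first odd exceptional base, kernel-checked
# (`K = 3`, classes `(5,5,5) mod 8`, all symbols `+1`)

Route `BiquadraticEisensteinDescent` (cell `pub/bsd-wall`, width seat `bsd-wall-cm-bed-w3` g24; `--supports` 21381, helper). The odd twin of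
`even_universality_fails` (p750799). Memo THEOREM-A-w3g22 recorded numerically that the one-stage odd door (THEOREM A, `exists_patternFree_design`,
p742384) has an exceptional class `κ_u + ε > τ₀` (which is why THEOREM B uses the two-stage door for μ = 1). Here it is certified in the kernel on
the smallest example: for the odd base with three primes `≡ 5 (mod 8)` that are pairwise quadratic residues (`n₀ ≡ 5 (mod 8)`, root number `−1`,
μ = 0 — the family of `odd_door_iff_of_negNegOne_false`, p754640) the virtual kernel is `V × 0`, so for EVERY `(δ, τ)` with `dim 𝒦⁺(δ) = 2τ` the
`V × 0` section of `𝒦⁺(δ)` has dimension `> τ`: ★★★ `odd_universality_fails`. THEOREMS ONLY; the crux as stated (C⁺), its registered stubs and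
BSD are NOT touched; nothing is closed.
Reference: [HeathBrown1994] D. R. Heath-Brown, Invent. Math. 118 (1994) 331–370, appendix (Monsky), typescript pp. 39–41.
-/

namespace Summit.BirchSwinnertonDyer.BirchSwinnertonDyer.Theorems.SymbolicMonsky

section OddCex

open Module Matrix

/-- For the explicit odd base `(5,5,5) mod 8` with all symbols `+1` (`K = 3`, `n₀ ≡ 5 (mod 8)`): every symbol bit vanishes. -/
private theorem ocex_neg (i j : Fin 3) : bz ((⟨![2, 2, 2], fun _ _ => false⟩ : SymbData 3).neg i j) = 0 := by
  revert i j
  decide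

/-- The virtual kernel of the explicit base is exactly `V × 0`. -/
private theorem ocex_kernel_eq :
    (⟨![2, 2, 2], fun _ _ => false⟩ : SymbData 3).virtualKernel =
      LinearMap.ker (LinearMap.snd (ZMod 2) (Fin 3 → ZMod 2) (Fin 3 → ZMod 2)) := by
  have hm : ∀ j : Fin 3, bz (negNegOne ((⟨![2, 2, 2], fun _ _ => false⟩ : SymbData 3).cls j)) = 0 := by decide
  have hd : ∀ j : Fin 3, bz (negTwo ((⟨![2, 2, 2], fun _ _ => false⟩ : SymbData 3).cls j)) = 1 := by decide
  ext p
  rw [mem_virtualKernel_iff, LinearMap.mem_ker, LinearMap.snd_apply]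
  simp only [ocex_neg, hm, hd, zero_mul, Finset.sum_const_zero, zero_add, one_mul, add_zero]
  constructor
  · rintro ⟨h1, -⟩
    funext i; exact h1 i
  · intro h
    exact ⟨fun i => by rw [h]; rfl, fun i => trivial⟩

/-- ★★★ **ODD UNIVERSALITY FAILS TOO (kernel-checked, `K = 3`).** For the odd base with classes `(5,5,5) mod 8` and all symbols `(P_j/P_i) = +1`
— root number `−1` (`n₀ ≡ 5 (mod 8)`), e.g. three primes `≡ 5 (mod 8)` that are pairwise quadratic residues — NO `(δ, τ)` satisfies the
hypotheses of THEOREM A (`exists_patternFree_design`, p742384): the virtual kernel is `V × 0` (dimension `3`), so every augmented kernel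
`𝒦⁺(δ)` has dimension `≤ 4` (`τ ≤ 2`) while its `V × 0` section has dimension `≥ 3`. The odd one-stage door has an exceptional class already
at `K = 3` (memo THEOREM-A-w3g22's `κ_u + ε > τ₀`, here certified; cf. `odd_door_iff_of_negNegOne_false`).
[cite: HeathBrown1994SelmerCongruentII, Appendix (Monsky), typescript pp. 39–41] -/
theorem odd_universality_fails :
    ∃ base : SymbData 3, (∑ b, (bz (negNegOne (base.cls b)) + bz (negTwo (base.cls b)))) = 1 ∧
      ∀ (δ : Fin 3 → ZMod 2) (τ : ℕ), finrank (ZMod 2) ↥(base.augKernel δ) = 2 * τ →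
        τ < finrank (ZMod 2) ↥(base.augKernel δ ⊓
          LinearMap.ker (LinearMap.snd (ZMod 2) (Fin 3 → ZMod 2) (Fin 3 → ZMod 2))) := by
  refine ⟨⟨![2, 2, 2], fun _ _ => false⟩, by decide, fun δ τ hdim => ?_⟩
  set base : SymbData 3 := ⟨![2, 2, 2], fun _ _ => false⟩ with hbase
  have hK : base.virtualKernel = LinearMap.ker (LinearMap.snd (ZMod 2) (Fin 3 → ZMod 2) (Fin 3 → ZMod 2)) := ocex_kernel_eq
  -- `finrank 𝒦 = 3`
  have hfinK : finrank (ZMod 2) ↥base.virtualKernel = 3 := by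
    rw [hK, LinearMap.ker_snd, LinearMap.finrank_range_of_inj LinearMap.inl_injective]
    simp [Module.finrank_fintype_fun_eq_card]
  -- `finrank 𝒦⁺(δ) ≤ 4`
  have hup : finrank (ZMod 2) ↥(base.augKernel δ) ≤ 4 := by
    unfold SymbData.augKernel
    refine (Submodule.finrank_add_le_finrank_add_finrank _ _).trans ?_
    rw [hfinK]
    have := finrank_span_le_card (R := ZMod 2) ({((δ, fun _ => (1 : ZMod 2)) : (Fin 3 → ZMod 2) × (Fin 3 → ZMod 2))} :
      Set ((Fin 3 → ZMod 2) × (Fin 3 → ZMod 2)))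
    simp only [Set.toFinset_singleton, Finset.card_singleton] at this
    omega
  -- the `V × 0` section contains `𝒦`
  have hlow : 3 ≤ finrank (ZMod 2) ↥(base.augKernel δ ⊓
      LinearMap.ker (LinearMap.snd (ZMod 2) (Fin 3 → ZMod 2) (Fin 3 → ZMod 2))) := by
    have hle : base.virtualKernel ≤ base.augKernel δ ⊓
        LinearMap.ker (LinearMap.snd (ZMod 2) (Fin 3 → ZMod 2) (Fin 3 → ZMod 2)) := by
      intro p hp
      refine Submodule.mem_inf.2 ⟨?_, by rw [← hK]; exact hp⟩
      unfold SymbData.augKernel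
      exact Submodule.mem_sup_left hp
    have hmono := Submodule.finrank_mono hle
    rw [hfinK] at hmono
    exact hmono
  omega

end OddCex

end Summit.BirchSwinnertonDyer.BirchSwinnertonDyer.Theorems.SymbolicMonsky
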